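import Summits.QuantumFields.YangMills.Theorems.BalabanUVNodesPortS1G3CDefs

/-!
# NODE O port PT-A — `G3CAtRecordL F`: THE REPAIRED G-P6 LETTER (edition L) over the body `P0CarrierClauses ∧ P0CarrierLatticeDecay` — the LATTICE-SCALE decay clause (P4-lat) that the
# generalized random walk expansion of `Tr (x + T)⁻¹` runs on, the repaired letter of `stub_G3C`, the matching P0-ℂ letter `P0HolExtAtRecordL`, and the two bookkeeping bridges
# (director-ym №565∕№566∕№568 (1): v3.4 edition of record (E-GL); ◆ CRIT-1 g37 stamps l.5243∕l.5286; porter hand `hand-27930-G3C` g0's verdict `stub-misstated: stub_G3C`)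

Cell `ym-nodeO-ideate`, porter hand `hand-27930-G3C` (g0); DEFINITION file (displayed letters the line posits + two binder-threading theorems), `--supports stmt-QuantumFields-27930 --as helper`;
count-neutral.  [16] = [Balaban1985UV3], [B9] = [Balaban1985BackgroundPropagators], [B4] = [Balaban1983RegularityDecay], [15] = [Balaban1985Variational], [I] = [Balaban1987RG1].

WHY (the hand's located obstruction, `Cruxes/PortRecordRepresentationS1/Lines/pta_residueW-stub_G3C-hand.md`).  `G3CAtRecord F` (✓`…PortS1G3CDefs`) is NOT DERIVABLE from its antecedent
`P0CarrierClauses` (✓`…K0RecordFormatNamesP0C`): (P4) bounds the carrier pieces `TY n Y φ` in SCHUR norm by `c₀·e^{−δ₀·dj Y}` where `dj` is the CUBE-SCALE tree length (`torusTreeLen`, closed unit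
cubes; `dj Y = 0` on vertex stars — ✓`TreeLengthDichotomy.treeLen_eq_zero_of_near` + ✓`torusTreeLen_image_le_treeLen`), so wall-neighbour inter-cube couplings are constrained by `‖·‖ ≤ c₀` only,
uniformly in `Mc` and `δ₀`; the conclusion demands pieces of `Tr (x + T)⁻¹` at an ARBITRARY rate `κt` (the glue needs `κt ≥ 4·kappa₀ 64 8 ≈ 1302`), whose only lever in print — «κ can be arbitrarily
large if M₁ is sufficiently large» ([16] (25) p.262) = the per-step factor `O(M^{−1/2})^{|ω|}` of (23) ⇐ [B9] (3.89)∕(3.94) — is the carrier's SEMI-LOCALITY AT THE UNIT-LATTICE SCALE.  A toy carrier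
satisfying every cube-scale clause with `(c₀, γ₀) = (5/2, ½)` admits no local holomorphic expansion of `Tr(x+T)⁻¹` (nor of `log det(x+T)`) with rate `> kappa₀ 64 8 + 3.8`, for any `Mc`, any `δ₀`.
The repair is ONE extra clause, supplied where the carrier is built and consumed where the walk expansion runs:
* (P4-lat) `P0CarrierLatticeDecay F δ₀ c₀ δ₁ Mc α₀ α₁ k TY` — on the record space of `Y`, the Schur ROW and COLUMN sums of `TY n Y φ` WEIGHTED BY `exp(δ₁ · tdist_k(i.src, j.src))` (level-`k`
  lattice units; `δ₁ > 0` absolute = a fraction of print's propagator decay rate, [B9] (3.42) p.399 ∕ [15] (190)) are `≤ c₀·e^{−δ₀·dj Y}`.  Implies (P4)'s Schur clause (weight ≥ 1); it is what the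
  physical (2.11) carrier `C_locᵀ Δ^{(k)} C_loc` has ([B9] Cor. 3.8 (3.94): walk-localized kernels with `e^{−δ₀·d(y,y′)}`).
* `G3CAtRecordL F` — `G3CAtRecord`'s prefix with `δ₁` quantified next to `c₀ γ₀ γ₁` (the thresholds `δG, Mth'` may answer to it; ◆'s (Q-ord) G-1 kept: thresholds `a₀`-free, `Bc` after `Mc`
  before `k`) and the body `P0CarrierClauses … → P0CarrierLatticeDecay … → ∃ EG EGZ, G3CPiecesAt …` — conclusion VERBATIM.  With (P4-lat) this is the complex ∕ field-localised ∕ torus edition of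
  [B4] (5.17) under (5.6) = (P5ᶜ) coercivity + lattice kernel decay; ROAD (hand's memo §5b): one-sided parametrix with sharp partition `𝟙_□` and `5^d` local blocks `tcollar (tblock □)`,
  smallness from the x-uniform Combes–Thomas decay across one cube (✓`…G3CCombesThomas`, ✓`…G3CResolvent`) plus `δ₀` for the pieces of size `≥ 1` (✓`…G3CStickOut`, ✓`…G3CPieceSum`),
  resummation ✓`…G3CParametrix` ∕ ✓`…G3CNeumann`, invariance ✓`…G3CInvariance`.
* `P0HolExtAtRecordL F` — `P0HolExtAtRecord`'s prefix with one more absolute constant `δ₁ > 0` and the body `P0CarrierClauses ∧ P0CarrierLatticeDecay` (DEF-1's guarded edition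
  `K0RecordFormatNames.P0HolExtAtRecordGL`, ✓`…K0RecordFormatNamesP0CGuardedL`, inserts the (G-b) guard after `0 < a₀ →` and is WEAKER than this one).
* `g3cAtRecordL_of_g3cAtRecord : G3CAtRecord F → G3CAtRecordL F` and `p0HolExtAtRecord_of_p0HolExtAtRecordL : P0HolExtAtRecordL F → P0HolExtAtRecord F` — the recut only ADDS a hypothesis
  where it is consumed and a conjunct where it is supplied.

HONEST FRAMING.  DISPLAYED statements (Prop-valued definitions, parameterless in their data beyond `F`) + two binder-threading theorems — asserted for nothing, inhabited NOWHERE today: the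
inhabitation of `P0HolExtAtRecordL` is [15] Prop. 9 ∕ Thm 1 (E2) content at the record WITH print's unit-lattice propagator decay (supplier node00-def-Y M2-ℂ), that of `G3CAtRecordL` is the
complex walk expansion (L, porter road above); neither is proved here or anywhere in the tree; `stub_P0C` ∕ `stub_G3C` ∕ `stub_LZdetGlue` ∕ `stub_FE` OPEN; 27930 OPEN (2∕6 by name);
K0ᴬ ∕ K1ᴬ ∕ K3ᴬ OPEN; NODE O 0∕1; COUNT 8∕28 · K 1∕4 UNMOVED; finite `𝕋⁴_{L^K}` at fixed ε — NOT continuum ∕ ℝ⁴ ∕ OS; **the Yang–Mills mass gap (Clay) is NOT proved by any of this.**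
No `sorry`, no `instance`, no `notation`; standard axioms.
-/

noncomputable section

open scoped BigOperators Matrix.Norms.L2Operator Topology
open Filter

namespace Summit.QuantumFields.YangMills.Theorems.BalabanUVNodesPortS1

open Summit.QuantumFields.YangMills.Theorems.K0RecordFormatNames
open Literature.MathematicalPhysics.QuantumFieldTheory.Balaban1983to89
open Literature.MathematicalPhysics.QuantumFieldTheory.Balaban1983to89.Node00
open Literature.MathematicalPhysics.QuantumFieldTheory.Balaban1983to89.T4Continuum (T4Family)

/-- **(P4-lat) LATTICE-SCALE SCHUR DECAY of the carrier pieces** — the letter the generalized random walk expansion runs on ([B9] (3.42) p.399 «|G′(y,y′)| ≤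
O(1) e^{−δ₀|y−y′|}» in UNIT-LATTICE distance; (3.89)/(3.94) p.409–410; [16] (23) p.262): on the record space of `Y`, for every row index `i`,
`Σ_j ‖TY n Y φ i j‖ · exp(δ₁ · tdist_k(i.src, j.src)) ≤ c₀ · exp(−δ₀ · dj Y)`, and the same for columns; `tdist_k` = `Site.tdist` on the level-`k` torus
(lattice units), `δ₁ > 0` absolute.  Implies (P4)'s unweighted Schur clause.  A predicate WITH PARAMETERS — asserts nothing.
[cite: Balaban1985BackgroundPropagators, (3.42) p.399, (3.89)–(3.94) p.409–410; Balaban1985UV3, (23) p.262; Balaban1983RegularityDecay, (5.6) p.594] -/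
def P0CarrierLatticeDecay (F : T4Family) (δ₀ c₀ δ₁ : ℝ) (Mc : ℕ) (α₀ α₁ : ℝ) (k : ℕ)
    (TY : (n : ℕ) → (recordDomSys F Mc k (recordK₀ F Mc k + n)).Dom → Sect2.CPair (F.P (recordK₀ F Mc k + n)) (MatA 2) →
        FluctIdx F k (recordK₀ F Mc k + n) → FluctIdx F k (recordK₀ F Mc k + n) → ℂ) : Prop :=
  ∀ (n : ℕ) (Y : (recordDomSys F Mc k (recordK₀ F Mc k + n)).Dom) (φ : Sect2.CPair (F.P (recordK₀ F Mc k + n)) (MatA 2)),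
    encodeCfg F (recordK₀ F Mc k + n) φ ∈ recordUc F Mc k α₀ α₁ (recordK₀ F Mc k + n) Y →
      (∀ i : FluctIdx F k (recordK₀ F Mc k + n),
        ∑ j : FluctIdx F k (recordK₀ F Mc k + n),
            ‖TY n Y φ i j‖ * Real.exp (δ₁ * (Site.tdist i.1.src j.1.src : ℝ)) ≤
          c₀ * Real.exp (-(δ₀ * (recordDomSys F Mc k (recordK₀ F Mc k + n)).dj Y))) ∧
      (∀ j : FluctIdx F k (recordK₀ F Mc k + n),
        ∑ i : FluctIdx F k (recordK₀ F Mc k + n),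
            ‖TY n Y φ i j‖ * Real.exp (δ₁ * (Site.tdist i.1.src j.1.src : ℝ)) ≤
          c₀ * Real.exp (-(δ₀ * (recordDomSys F Mc k (recordK₀ F Mc k + n)).dj Y)))

/-- **`G3CAtRecordL F` — THE REPAIRED G-P6 LETTER**: `G3CAtRecord` with the lattice rate `δ₁` quantified next to the absolute constants `c₀ γ₀ γ₁` (so the
thresholds `δG`, `Mth'` may answer to it) and (P4-lat) added to the body; the CONCLUSION `∃ EG EGZ, G3CPiecesAt …` is UNCHANGED.  This is the complex ∕
field-localised ∕ torus edition of [B4] (5.17) under (5.6) = (P5ᶜ) coercivity + (P4-lat) lattice kernel decay, «M sufficiently large» = `Mth'(κt, …)`.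
DISPLAYED; inhabited nowhere. [cite: Balaban1983RegularityDecay, (5.6) p.594, (5.17) p.40; Balaban1985UV3, (23)–(25) p.262, (63) p.272;
Balaban1985BackgroundPropagators, (3.90) p.409] -/
def G3CAtRecordL (F : T4Family) : Prop :=
  ∀ κt : ℝ, 0 < κt →
  ∀ c₀ γ₀ γ₁ δ₁ : ℝ, 0 < c₀ → 0 < γ₀ → γ₀ ≤ γ₁ → 0 < δ₁ →
  ∃ δG : ℝ, 0 < δG ∧ ∃ Mth' : ℕ,
  ∀ δ₀ : ℝ, δG ≤ δ₀ → ∀ Mc : ℕ, Mth' ≤ Mc → McGuard F Mc →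
  ∃ Bc : ℝ, 0 ≤ Bc ∧
  ∀ a₀ α₀ α₁ ε₂₉ : ℝ, 0 < a₀ → 0 < α₀ → 0 < α₁ → 0 < ε₂₉ → ∀ (k : ℕ) TC TY TZY AdM AdZ,
    P0CarrierClauses F a₀ δ₀ c₀ γ₀ γ₁ Mc α₀ α₁ ε₂₉ k TC TY TZY AdM AdZ →
    P0CarrierLatticeDecay F δ₀ c₀ δ₁ Mc α₀ α₁ k TY →
    ∃ EG EGZ, G3CPiecesAt F Mc k a₀ ε₂₉ α₀ α₁ κt Bc TC EG EGZ

/-- **The letter of record implies the repaired letter** (the recut only ADDS the hypothesis (P4-lat) and the binder `δ₁`): nothing downstream is lost.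
[cite: Balaban1985UV3, (25) p.262 (bookkeeping)] -/
theorem g3cAtRecordL_of_g3cAtRecord (F : T4Family) (h : G3CAtRecord F) : G3CAtRecordL F := by
  intro κt hκt c₀ γ₀ γ₁ δ₁ hc₀ hγ₀ hγ _hδ₁
  obtain ⟨δG, hδG, Mth', hrest⟩ := h κt hκt c₀ γ₀ γ₁ hc₀ hγ₀ hγ
  refine ⟨δG, hδG, Mth', fun δ₀ hδ₀ Mc hMc hG => ?_⟩
  obtain ⟨Bc, hBc, hall⟩ := hrest δ₀ hδ₀ Mc hMc hG
  exact ⟨Bc, hBc, fun a₀ α₀ α₁ ε₂₉ ha₀ hα₀ hα₁ hε k TC TY TZY AdM AdZ hP _hL =>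
    hall a₀ α₀ α₁ ε₂₉ ha₀ hα₀ hα₁ hε k TC TY TZY AdM AdZ hP⟩

/-- **The repaired P0-ℂ letter** the recut asks of `stub_P0C`'s supplier (node00-def-Y M2-ℂ): `P0HolExtAtRecord`'s prefix with one more absolute constant
`δ₁ > 0` and the body `P0CarrierClauses ∧ P0CarrierLatticeDecay` (print: the (2.11) carrier `C_locᵀ Δ^{(k)} C_loc` is exponentially localized at the
UNIT-LATTICE scale, [15] (190) p.309 ∕ [B9] (3.42)).  DISPLAYED; inhabited nowhere. [cite: Balaban1985Variational, Prop. 9 p.309; Balaban1985BackgroundPropagators, (3.42) p.399] -/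
def P0HolExtAtRecordL (F : T4Family) : Prop :=
  ∃ c₀ γ₀ γ₁ δ₁ : ℝ, 0 < c₀ ∧ 0 < γ₀ ∧ γ₀ ≤ γ₁ ∧ 0 < δ₁ ∧
  ∀ δ₀ : ℝ, 0 < δ₀ → ∃ Mth : ℕ, ∀ Mc : ℕ, Mth ≤ Mc → McGuard F Mc →
  ∀ a₀ : ℝ, 0 < a₀ →
  ∃ α₀ α₁ : ℝ, 0 < α₀ ∧ 0 < α₁ ∧
  ∀ ε₂₉ : ℝ, 0 < ε₂₉ → ∀ k : ℕ,
    ∃ TC TY TZY AdM AdZ, P0CarrierClauses F a₀ δ₀ c₀ γ₀ γ₁ Mc α₀ α₁ ε₂₉ k TC TY TZY AdM AdZ ∧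
      P0CarrierLatticeDecay F δ₀ c₀ δ₁ Mc α₀ α₁ k TY

/-- **The repaired P0-ℂ letter implies the letter of record** (it only adds (P4-lat)): `stub_P0C`'s statement is unchanged in strength for every other consumer.
[cite: Balaban1985Variational, Prop. 9 p.309 (bookkeeping)] -/
theorem p0HolExtAtRecord_of_p0HolExtAtRecordL (F : T4Family) (h : P0HolExtAtRecordL F) : P0HolExtAtRecord F := by
  obtain ⟨c₀, γ₀, γ₁, _δ₁, hc₀, hγ₀, hγ, _hδ₁, hrest⟩ := h
  refine ⟨c₀, γ₀, γ₁, hc₀, hγ₀, hγ, fun δ₀ hδ₀ => ?_⟩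
  obtain ⟨Mth, hM⟩ := hrest δ₀ hδ₀
  refine ⟨Mth, fun Mc hMc hG a₀ ha₀ => ?_⟩
  obtain ⟨α₀, α₁, hα₀, hα₁, hk⟩ := hM Mc hMc hG a₀ ha₀
  refine ⟨α₀, α₁, hα₀, hα₁, fun ε₂₉ hε k => ?_⟩
  obtain ⟨TC, TY, TZY, AdM, AdZ, hP, -⟩ := hk ε₂₉ hε k
  exact ⟨TC, TY, TZY, AdM, AdZ, hP⟩

end Summit.QuantumFields.YangMills.Theorems.BalabanUVNodesPortS1

end
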